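import Summits.QuantumFields.BalabanUV.Beta.EriceFlowEnclosureB12AsPrintedHistoryContagionShiftFlowZeroTangentSecondQuotient

/-!
# Beta / EriceFlowEnclosureB12AsPrintedHistoryContagionShiftFlowZeroTangentSecondPerturb — ASYMPTOTIC FREEDOM IS CONTAGIOUS, part 82: THE DERIVED EQUATION AT TWO DATA SETS —
# ABSTRACT AND B-FREE, in the language of parts 66 and 79.  Two derived linear memory equations (part 78's shape)
# `V_k = −Σ_{p<k}Σ_j (c₁v + cv₁)_{p,j}W_{p+1+j} − Σ_{p<k}Σ_j c_{p,j}v_{p+1+j}V_{p+1+j}` and the same with data `(c̃, ṽ, c̃₁, ṽ₁, W̃)`, under part 66's standing bounds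
# (`|c|, |c̃| ≤ C_mθ^j`, `|v|, |ṽ| ≤ w∕2`), derived bounds (`|c₁| ≤ C₁θ^j`, `|ṽ₁| ≤ D₁w`) and five closeness letters — `|c̃ − c| ≤ η_G·C_mθ^j` (RELATIVE form, part 71),
# `|ṽ − v| ≤ η_dw`, `|c̃₁ − c₁| ≤ η₁θ^j`, `|ṽ₁ − v₁| ≤ η_{v1}w`, `|W̃ − W| ≤ η_W`.  (§149) Every summand of the second derived source is `η_σθ^jw`-close to the first,
# `η_σ = (η₁∕2 + C₁η_d + η_GC_mD₁ + C_mη_{v1})M′ + (C₁∕2 + C_mD₁)η_W` (five-term split), so the derived sources are `η_σS∕(1−θ)`-close at every scale; the kernels are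
# `C_mθ^jw(η_G∕2 + η_d)`-close.  (§150) ONE application of part 66's `fixedPoint_perturb` (kernel AND source vary): **`|Ṽ_k − V_k| ≤ (η_σS∕(1−θ) + C_mS(η_G∕2 +
# η_d)M_V∕(1−θ))∕(1 − C_mS∕(2(1−θ)))` FOR EVERY k**.  Part 83 supplies the five smallnesses at flow level (the two new ones — the derived coefficients and the derived Jacobian at
# two pins — from the continuity letter `hHc` of the Hessian) and concludes: the second tangent flow and its ultraviolet limit are CONTINUOUS in the pin, Λ ∈ C²
# (β-flow team, prover 1, unit `b2b-balaban-beta-bflow-p1`, gen 43; ROW AP-I·Uc × NODE U2)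

HONEST FRAMING (page 1 of everything the β sub-cell writes): discharging `BetaPertH` makes Bałaban's UV stability UNCONDITIONAL — a
real constructive-QFT result; it is NOT the continuum limit and NOT the Clay problem.  HONEST DEPENDENCY (cell reorg 2026-08-19,
verbatim): «continuum YM on T⁴ ⇐ BetaPertH ∧ nine spine estimates (0/9 proved); BetaPertH ⇐ (D1) ∧ (D4) ∧ CAP+tail; G-an2-4 gates
asym, D1 and NE2/3/4.»  THIS MODULE DISCHARGES NOTHING: [folklore] real analysis (the triangle inequality, row-wise `tsum` algebra, parts 66 and 79's kernel ∕ perturbation ∕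
summability lemmas) — NO functional B, no flow, no solution appears; parts 66, 79 BY NAME.  [I] = T. Bałaban, Commun. Math. Phys. **109** (1987) [Balaban1987RG1] prints the
recursion (0.20) p. 256 and Theorem 2 (0.31) p. 259 (STATED WITHOUT PROOF); nothing of this linear algebra is in [I] and nothing of Bałaban's β is asserted.

WHAT THIS FILE PROVES (0 sorry, 0 def): §149 **`derivedIntegrand_sub_abs_le`**, **`derivedSource_sub_abs_le`**, `kernel_sub_abs_le`; §150 **`secondTangent_perturb`**.
NOT CLAIMED: anything at flow level (part 83); anything about Bałaban's β; `BetaPertH`; the continuum limit of the measures; Clay.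
-/

namespace Summit.QuantumFields.BalabanUV.Beta.EriceFlowEnclosureB12AsPrintedHistoryContagionShiftFlowZeroTangentSecondPerturb

open Finset Filter Topology
open Summit.QuantumFields.BalabanUV.Beta.EriceFlowEnclosureB12AsPrintedHistoryContagionShiftFlowZeroTangent (kernel_abs_le fixedPoint_perturb)
open Summit.QuantumFields.BalabanUV.Beta.EriceFlowEnclosureB12AsPrintedHistoryContagionShiftFlowZeroTangentSecondQuotient (secondIntegrand_summable)

noncomputable section

/-! ## §149 The derived sources and kernels at two data sets -/

/-- **THE FIVE-TERM SPLIT.**  `(c̃₁ṽ + c̃ṽ₁)W̃ − (c₁v + cv₁)W = [(c̃₁ − c₁)ṽ + c₁(ṽ − v) + (c̃ − c)ṽ₁ + c(ṽ₁ − v₁)]W̃ + (c₁v + cv₁)(W̃ − W)`; under the standing, derived and closeness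
bounds every summand is **`≤ η_σθ^jw_q`**, `η_σ = (η₁∕2 + C₁η_d + η_GC_mD₁ + C_mη_{v1})M′ + (C₁∕2 + C_mD₁)η_W`. [folklore] -/
theorem derivedIntegrand_sub_abs_le {Cm C₁ D₁ θ M' ηG ηd η₁ ηv1 ηW : ℝ} {w : ℕ → ℝ} {c cc c₁ cc₁ : ℕ → ℕ → ℝ} {v vv v₁ vv₁ W WW : ℕ → ℝ}
    (hCm : 0 ≤ Cm) (hC₁ : 0 ≤ C₁) (hD₁ : 0 ≤ D₁) (hθ0 : 0 ≤ θ) (hw0 : ∀ q, 0 ≤ w q)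
    (hc : ∀ p j, |c p j| ≤ Cm * θ ^ j) (hvv : ∀ q, |vv q| ≤ w q / 2) (hv : ∀ q, |v q| ≤ w q / 2)
    (hc₁ : ∀ p j, |c₁ p j| ≤ C₁ * θ ^ j) (hv₁ : ∀ q, |v₁ q| ≤ D₁ * w q) (hvv₁ : ∀ q, |vv₁ q| ≤ D₁ * w q) (hWWM : ∀ q, |WW q| ≤ M')
    (hηG0 : 0 ≤ ηG) (hηG : ∀ p j, |cc p j - c p j| ≤ ηG * (Cm * θ ^ j)) (hηd : ∀ q, |vv q - v q| ≤ ηd * w q)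
    (hη₁0 : 0 ≤ η₁) (hη₁ : ∀ p j, |cc₁ p j - c₁ p j| ≤ η₁ * θ ^ j) (hηv1 : ∀ q, |vv₁ q - v₁ q| ≤ ηv1 * w q)
    (hηW : ∀ q, |WW q - W q| ≤ ηW) (p j : ℕ) :
    |(cc₁ p j * vv (p + 1 + j) + cc p j * vv₁ (p + 1 + j)) * WW (p + 1 + j) - (c₁ p j * v (p + 1 + j) + c p j * v₁ (p + 1 + j)) * W (p + 1 + j)|
      ≤ ((η₁ / 2 + C₁ * ηd + ηG * Cm * D₁ + Cm * ηv1) * M' + (C₁ / 2 + Cm * D₁) * ηW) * θ ^ j * (w (p + 1 + j) * 1) := by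
  have hθj : 0 ≤ θ ^ j := pow_nonneg hθ0 j
  have hwq := hw0 (p + 1 + j)
  have hE : (cc₁ p j * vv (p + 1 + j) + cc p j * vv₁ (p + 1 + j)) * WW (p + 1 + j) - (c₁ p j * v (p + 1 + j) + c p j * v₁ (p + 1 + j)) * W (p + 1 + j)
      = ((cc₁ p j - c₁ p j) * vv (p + 1 + j) + c₁ p j * (vv (p + 1 + j) - v (p + 1 + j)) + (cc p j - c p j) * vv₁ (p + 1 + j)
          + c p j * (vv₁ (p + 1 + j) - v₁ (p + 1 + j))) * WW (p + 1 + j)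
        + (c₁ p j * v (p + 1 + j) + c p j * v₁ (p + 1 + j)) * (WW (p + 1 + j) - W (p + 1 + j)) := by ring
  rw [hE]
  have h1 : |(cc₁ p j - c₁ p j) * vv (p + 1 + j)| ≤ η₁ * θ ^ j * (w (p + 1 + j) / 2) := by
    rw [abs_mul]; exact mul_le_mul (hη₁ p j) (hvv _) (abs_nonneg _) (by positivity)
  have h2 : |c₁ p j * (vv (p + 1 + j) - v (p + 1 + j))| ≤ C₁ * θ ^ j * (ηd * w (p + 1 + j)) := by
    rw [abs_mul]; exact mul_le_mul (hc₁ p j) (hηd _) (abs_nonneg _) (by positivity)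
  have h3 : |(cc p j - c p j) * vv₁ (p + 1 + j)| ≤ ηG * (Cm * θ ^ j) * (D₁ * w (p + 1 + j)) := by
    rw [abs_mul]; exact mul_le_mul (hηG p j) (hvv₁ _) (abs_nonneg _) (by positivity)
  have h4 : |c p j * (vv₁ (p + 1 + j) - v₁ (p + 1 + j))| ≤ Cm * θ ^ j * (ηv1 * w (p + 1 + j)) := by
    rw [abs_mul]; exact mul_le_mul (hc p j) (hηv1 _) (abs_nonneg _) (by positivity)
  have h5 : |c₁ p j * v (p + 1 + j) + c p j * v₁ (p + 1 + j)| ≤ C₁ * θ ^ j * (w (p + 1 + j) / 2) + Cm * θ ^ j * (D₁ * w (p + 1 + j)) := by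
    refine (abs_add_le _ _).trans (add_le_add ?_ ?_)
    · rw [abs_mul]; exact mul_le_mul (hc₁ p j) (hv _) (abs_nonneg _) (by positivity)
    · rw [abs_mul]; exact mul_le_mul (hc p j) (hv₁ _) (abs_nonneg _) (by positivity)
  have hX : |(cc₁ p j - c₁ p j) * vv (p + 1 + j) + c₁ p j * (vv (p + 1 + j) - v (p + 1 + j)) + (cc p j - c p j) * vv₁ (p + 1 + j)
        + c p j * (vv₁ (p + 1 + j) - v₁ (p + 1 + j))|
      ≤ η₁ * θ ^ j * (w (p + 1 + j) / 2) + C₁ * θ ^ j * (ηd * w (p + 1 + j)) + ηG * (Cm * θ ^ j) * (D₁ * w (p + 1 + j))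
        + Cm * θ ^ j * (ηv1 * w (p + 1 + j)) :=
    (abs_add_le _ _).trans (add_le_add ((abs_add_le _ _).trans (add_le_add ((abs_add_le _ _).trans (add_le_add h1 h2)) h3)) h4)
  have hXW : |((cc₁ p j - c₁ p j) * vv (p + 1 + j) + c₁ p j * (vv (p + 1 + j) - v (p + 1 + j)) + (cc p j - c p j) * vv₁ (p + 1 + j)
        + c p j * (vv₁ (p + 1 + j) - v₁ (p + 1 + j))) * WW (p + 1 + j)|
      ≤ (η₁ * θ ^ j * (w (p + 1 + j) / 2) + C₁ * θ ^ j * (ηd * w (p + 1 + j)) + ηG * (Cm * θ ^ j) * (D₁ * w (p + 1 + j))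
        + Cm * θ ^ j * (ηv1 * w (p + 1 + j))) * M' := by
    rw [abs_mul]
    exact mul_le_mul hX (hWWM _) (abs_nonneg _) ((abs_nonneg _).trans hX)
  have hYW : |(c₁ p j * v (p + 1 + j) + c p j * v₁ (p + 1 + j)) * (WW (p + 1 + j) - W (p + 1 + j))|
      ≤ (C₁ * θ ^ j * (w (p + 1 + j) / 2) + Cm * θ ^ j * (D₁ * w (p + 1 + j))) * ηW := by
    rw [abs_mul]
    exact mul_le_mul h5 (hηW _) (abs_nonneg _) (by positivity)
  calc _ ≤ (η₁ * θ ^ j * (w (p + 1 + j) / 2) + C₁ * θ ^ j * (ηd * w (p + 1 + j)) + ηG * (Cm * θ ^ j) * (D₁ * w (p + 1 + j))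
          + Cm * θ ^ j * (ηv1 * w (p + 1 + j))) * M'
        + (C₁ * θ ^ j * (w (p + 1 + j) / 2) + Cm * θ ^ j * (D₁ * w (p + 1 + j))) * ηW := (abs_add_le _ _).trans (add_le_add hXW hYW)
    _ = ((η₁ / 2 + C₁ * ηd + ηG * Cm * D₁ + Cm * ηv1) * M' + (C₁ / 2 + Cm * D₁) * ηW) * θ ^ j * (w (p + 1 + j) * 1) := by ring

/-- **THE DERIVED SOURCES ARE `η_σS∕(1−θ)`-CLOSE AT EVERY SCALE** (row-wise `tsum_sub` with part 79's summability of derived rows, then part 66's kernel lemma). [folklore] -/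
theorem derivedSource_sub_abs_le {Cm C₁ D₁ θ S M M' ηG ηd η₁ ηv1 ηW : ℝ} {w : ℕ → ℝ} {c cc c₁ cc₁ : ℕ → ℕ → ℝ} {v vv v₁ vv₁ W WW : ℕ → ℝ}
    (hCm : 0 ≤ Cm) (hC₁ : 0 ≤ C₁) (hD₁ : 0 ≤ D₁) (hθ0 : 0 ≤ θ) (hθ1 : θ < 1)
    (hw0 : ∀ q, 0 ≤ w q) (hwanti : ∀ {a b : ℕ}, a ≤ b → w b ≤ w a) (hwS : ∀ m, ∑ q ∈ range (m + 1), w q ≤ S) (hM' : 0 ≤ M')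
    (hc : ∀ p j, |c p j| ≤ Cm * θ ^ j) (hcc : ∀ p j, |cc p j| ≤ Cm * θ ^ j) (hv : ∀ q, |v q| ≤ w q / 2) (hvv : ∀ q, |vv q| ≤ w q / 2)
    (hc₁ : ∀ p j, |c₁ p j| ≤ C₁ * θ ^ j) (hcc₁ : ∀ p j, |cc₁ p j| ≤ (C₁ + η₁) * θ ^ j) (hv₁ : ∀ q, |v₁ q| ≤ D₁ * w q) (hvv₁ : ∀ q, |vv₁ q| ≤ D₁ * w q)
    (hWM : ∀ q, |W q| ≤ M) (hWWM : ∀ q, |WW q| ≤ M')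
    (hηG0 : 0 ≤ ηG) (hηG : ∀ p j, |cc p j - c p j| ≤ ηG * (Cm * θ ^ j)) (hηd0 : 0 ≤ ηd) (hηd : ∀ q, |vv q - v q| ≤ ηd * w q)
    (hη₁0 : 0 ≤ η₁) (hη₁ : ∀ p j, |cc₁ p j - c₁ p j| ≤ η₁ * θ ^ j) (hηv10 : 0 ≤ ηv1) (hηv1 : ∀ q, |vv₁ q - v₁ q| ≤ ηv1 * w q)
    (hηW0 : 0 ≤ ηW) (hηW : ∀ q, |WW q - W q| ≤ ηW) (k : ℕ) :
    |(-∑ p ∈ range k, ∑' j, (cc₁ p j * vv (p + 1 + j) + cc p j * vv₁ (p + 1 + j)) * WW (p + 1 + j))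
        - (-∑ p ∈ range k, ∑' j, (c₁ p j * v (p + 1 + j) + c p j * v₁ (p + 1 + j)) * W (p + 1 + j))|
      ≤ ((η₁ / 2 + C₁ * ηd + ηG * Cm * D₁ + Cm * ηv1) * M' + (C₁ / 2 + Cm * D₁) * ηW) * S * 1 / (1 - θ) := by
  have hη : 0 ≤ (η₁ / 2 + C₁ * ηd + ηG * Cm * D₁ + Cm * ηv1) * M' + (C₁ / 2 + Cm * D₁) * ηW := by positivity
  have hF := derivedIntegrand_sub_abs_le hCm hC₁ hD₁ hθ0 hw0 hc hvv hv hc₁ hv₁ hvv₁ hWWM hηG0 hηG hηd hη₁0 hη₁ hηv1 hηW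
  have hT : ∀ p, Summable fun j => (c₁ p j * v (p + 1 + j) + c p j * v₁ (p + 1 + j)) * W (p + 1 + j) :=
    secondIntegrand_summable hCm hC₁ hD₁ hθ0 hθ1 hw0 hwanti hc hv hc₁ hv₁ hWM
  have hTT : ∀ p, Summable fun j => (cc₁ p j * vv (p + 1 + j) + cc p j * vv₁ (p + 1 + j)) * WW (p + 1 + j) :=
    secondIntegrand_summable hCm (by positivity : 0 ≤ C₁ + η₁) hD₁ hθ0 hθ1 hw0 hwanti hcc hvv hcc₁ hvv₁ hWWM
  have hk := kernel_abs_le hθ0 hθ1 hw0 hwanti hwS zero_le_one hη hF k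
  have e1 : (-∑ p ∈ range k, ∑' j, (cc₁ p j * vv (p + 1 + j) + cc p j * vv₁ (p + 1 + j)) * WW (p + 1 + j))
        - (-∑ p ∈ range k, ∑' j, (c₁ p j * v (p + 1 + j) + c p j * v₁ (p + 1 + j)) * W (p + 1 + j))
      = -∑ p ∈ range k, ∑' j, ((cc₁ p j * vv (p + 1 + j) + cc p j * vv₁ (p + 1 + j)) * WW (p + 1 + j)
          - (c₁ p j * v (p + 1 + j) + c p j * v₁ (p + 1 + j)) * W (p + 1 + j)) := by
    rw [Finset.sum_congr rfl fun p _ => (hTT p).tsum_sub (hT p), Finset.sum_sub_distrib]; ring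
  rw [e1, abs_neg]
  exact hk

/-- **THE KERNELS ARE CLOSE**: `|c̃ − c| ≤ η_G·C_mθ^j` and `|ṽ − v| ≤ η_dw` ⟹ **`|c_{p,j}v_q − c̃_{p,j}ṽ_q| ≤ C_mθ^j·w_q·(η_G∕2 + η_d)`** — part 66's kernel-closeness letter `hE`.
[folklore] -/
theorem kernel_sub_abs_le {Cm θ ηG ηd : ℝ} {w : ℕ → ℝ} {c cc : ℕ → ℕ → ℝ} {v vv : ℕ → ℝ} (hCm : 0 ≤ Cm) (hθ0 : 0 ≤ θ) (hw0 : ∀ q, 0 ≤ w q)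
    (hcc : ∀ p j, |cc p j| ≤ Cm * θ ^ j) (hv : ∀ q, |v q| ≤ w q / 2)
    (hηG0 : 0 ≤ ηG) (hηG : ∀ p j, |cc p j - c p j| ≤ ηG * (Cm * θ ^ j)) (hηd : ∀ q, |vv q - v q| ≤ ηd * w q) (p j : ℕ) :
    |c p j * v (p + 1 + j) - cc p j * vv (p + 1 + j)| ≤ Cm * θ ^ j * (w (p + 1 + j) * (ηG / 2 + ηd)) := by
  have hθj : 0 ≤ θ ^ j := pow_nonneg hθ0 j
  have hwq := hw0 (p + 1 + j)
  have hE : c p j * v (p + 1 + j) - cc p j * vv (p + 1 + j)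
      = -((cc p j - c p j) * v (p + 1 + j)) - cc p j * (vv (p + 1 + j) - v (p + 1 + j)) := by ring
  rw [hE]
  have h1 : |(cc p j - c p j) * v (p + 1 + j)| ≤ ηG * (Cm * θ ^ j) * (w (p + 1 + j) / 2) := by
    rw [abs_mul]; exact mul_le_mul (hηG p j) (hv _) (abs_nonneg _) (by positivity)
  have h2 : |cc p j * (vv (p + 1 + j) - v (p + 1 + j))| ≤ Cm * θ ^ j * (ηd * w (p + 1 + j)) := by
    rw [abs_mul]; exact mul_le_mul (hcc p j) (hηd _) (abs_nonneg _) (by positivity)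
  calc |-((cc p j - c p j) * v (p + 1 + j)) - cc p j * (vv (p + 1 + j) - v (p + 1 + j))|
      ≤ |-((cc p j - c p j) * v (p + 1 + j))| + |cc p j * (vv (p + 1 + j) - v (p + 1 + j))| := abs_sub _ _
    _ ≤ ηG * (Cm * θ ^ j) * (w (p + 1 + j) / 2) + Cm * θ ^ j * (ηd * w (p + 1 + j)) := by rw [abs_neg]; exact add_le_add h1 h2
    _ = Cm * θ ^ j * (w (p + 1 + j) * (ηG / 2 + ηd)) := by ring

/-! ## §150 The second tangent flows at two data sets: one `fixedPoint_perturb` with kernel and source varying -/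

/-- **THE DERIVED EQUATION AT TWO DATA SETS.**  Data (c, v, c₁, v₁, W) and (c̃, ṽ, c̃₁, ṽ₁, W̃) under part 66's standing bounds (smallness `C_mS∕(2(1−θ)) ≤ 1∕2`), derived bounds
`|c₁| ≤ C₁θ^j`, `|v₁|, |ṽ₁| ≤ D₁w`, the five closeness letters; V, Ṽ bounded solutions (by `M_V`, `M_Ṽ`) of the two derived equations.  THEN FOR EVERY k:
**`|V_k − Ṽ_k| ≤ (η_σS∕(1−θ) + C_mS·((η_G∕2 + η_d)M_Ṽ)∕(1−θ))∕(1 − C_mS∕(2(1−θ)))`**, `η_σ` of §149 — part 66's `fixedPoint_perturb` with the kernel letter of `kernel_sub_abs_le` and the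
source letter of `derivedSource_sub_abs_le`. [folklore] -/
theorem secondTangent_perturb {Cm C₁ D₁ θ S M M' MV MVV ηG ηd η₁ ηv1 ηW : ℝ} {w : ℕ → ℝ} {c cc c₁ cc₁ : ℕ → ℕ → ℝ} {v vv v₁ vv₁ W WW V VV : ℕ → ℝ}
    (hCm : 0 ≤ Cm) (hC₁ : 0 ≤ C₁) (hD₁ : 0 ≤ D₁) (hθ0 : 0 ≤ θ) (hθ1 : θ < 1)
    (hw0 : ∀ q, 0 ≤ w q) (hwanti : ∀ {a b : ℕ}, a ≤ b → w b ≤ w a) (hwS : ∀ m, ∑ q ∈ range (m + 1), w q ≤ S)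
    (hq : Cm * S / (2 * (1 - θ)) ≤ 1 / 2) (hM' : 0 ≤ M')
    (hc : ∀ p j, |c p j| ≤ Cm * θ ^ j) (hcc : ∀ p j, |cc p j| ≤ Cm * θ ^ j) (hv : ∀ q, |v q| ≤ w q / 2) (hvv : ∀ q, |vv q| ≤ w q / 2)
    (hc₁ : ∀ p j, |c₁ p j| ≤ C₁ * θ ^ j) (hcc₁ : ∀ p j, |cc₁ p j| ≤ (C₁ + η₁) * θ ^ j) (hv₁ : ∀ q, |v₁ q| ≤ D₁ * w q) (hvv₁ : ∀ q, |vv₁ q| ≤ D₁ * w q)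
    (hWM : ∀ q, |W q| ≤ M) (hWWM : ∀ q, |WW q| ≤ M')
    (hV : ∀ k, V k = (-∑ p ∈ range k, ∑' j, (c₁ p j * v (p + 1 + j) + c p j * v₁ (p + 1 + j)) * W (p + 1 + j))
      - ∑ p ∈ range k, ∑' j, c p j * v (p + 1 + j) * V (p + 1 + j)) (hVM : ∀ q, |V q| ≤ MV)
    (hVV : ∀ k, VV k = (-∑ p ∈ range k, ∑' j, (cc₁ p j * vv (p + 1 + j) + cc p j * vv₁ (p + 1 + j)) * WW (p + 1 + j))
      - ∑ p ∈ range k, ∑' j, cc p j * vv (p + 1 + j) * VV (p + 1 + j)) (hVVM : ∀ q, |VV q| ≤ MVV)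
    (hηG0 : 0 ≤ ηG) (hηG : ∀ p j, |cc p j - c p j| ≤ ηG * (Cm * θ ^ j)) (hηd0 : 0 ≤ ηd) (hηd : ∀ q, |vv q - v q| ≤ ηd * w q)
    (hη₁0 : 0 ≤ η₁) (hη₁ : ∀ p j, |cc₁ p j - c₁ p j| ≤ η₁ * θ ^ j) (hηv10 : 0 ≤ ηv1) (hηv1 : ∀ q, |vv₁ q - v₁ q| ≤ ηv1 * w q)
    (hηW0 : 0 ≤ ηW) (hηW : ∀ q, |WW q - W q| ≤ ηW) (k : ℕ) :
    |V k - VV k|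
      ≤ (((η₁ / 2 + C₁ * ηd + ηG * Cm * D₁ + Cm * ηv1) * M' + (C₁ / 2 + Cm * D₁) * ηW) * S * 1 / (1 - θ)
          + Cm * S * ((ηG / 2 + ηd) * MVV) / (1 - θ)) / (1 - Cm * S / (2 * (1 - θ))) := by
  have hss : ∀ k, |(fun k => -∑ p ∈ range k, ∑' j, (c₁ p j * v (p + 1 + j) + c p j * v₁ (p + 1 + j)) * W (p + 1 + j)) k
      - (fun k => -∑ p ∈ range k, ∑' j, (cc₁ p j * vv (p + 1 + j) + cc p j * vv₁ (p + 1 + j)) * WW (p + 1 + j)) k|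
      ≤ ((η₁ / 2 + C₁ * ηd + ηG * Cm * D₁ + Cm * ηv1) * M' + (C₁ / 2 + Cm * D₁) * ηW) * S * 1 / (1 - θ) := fun k => by
    rw [abs_sub_comm]
    exact derivedSource_sub_abs_le hCm hC₁ hD₁ hθ0 hθ1 hw0 hwanti hwS hM' hc hcc hv hvv hc₁ hcc₁ hv₁ hvv₁ hWM hWWM hηG0 hηG hηd0 hηd hη₁0 hη₁ hηv10 hηv1
      hηW0 hηW k
  have hE := kernel_sub_abs_le hCm hθ0 hw0 hcc hv hηG0 hηG hηd
  have hV' : ∀ k, V k = (fun k => -∑ p ∈ range k, ∑' j, (c₁ p j * v (p + 1 + j) + c p j * v₁ (p + 1 + j)) * W (p + 1 + j)) k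
      - ∑ p ∈ range k, ∑' j, c p j * v (p + 1 + j) * V (p + 1 + j) := hV
  have hVV' : ∀ k, VV k = (fun k => -∑ p ∈ range k, ∑' j, (cc₁ p j * vv (p + 1 + j) + cc p j * vv₁ (p + 1 + j)) * WW (p + 1 + j)) k
      - ∑ p ∈ range k, ∑' j, cc p j * vv (p + 1 + j) * VV (p + 1 + j) := hVV
  exact fixedPoint_perturb hCm hθ0 hθ1 hw0 hwanti hwS hq hc hv hcc hvv hV' hVM hVV' hVVM hss (by positivity) hE k

end

end Summit.QuantumFields.BalabanUV.Beta.EriceFlowEnclosureB12AsPrintedHistoryContagionShiftFlowZeroTangentSecondPerturb
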